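import Literature.MathematicalPhysics.QuantumLattice.HubbardTTPrimeSourcedParticleHole
import Literature.MathematicalPhysics.QuantumLattice.DWaveOrderParameterQuasiAverageState
import HarnessLib

/-!
# Particle–hole symmetry of the Koma–Tasaki `d`-wave ORDER PARAMETER at `t' ≠ 0`:
# `m⋆(−t', U; U − μ) = m⋆(t', U; μ)` — electron doping at `t'` is hole doping at `−t'`

Topic `MathematicalPhysics/QuantumLattice` (namespace = path; family `hubbard`). The `t' ≠ 0` twin of
`DWaveOrderParameterParticleHole` (`m⋆(0, U; U − μ) = m⋆(0, U; μ)`, hubbard-cq), on the state-level `t–t'` particle–hole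
dictionary of `HubbardTTPrimeSourcedParticleHole` (`e^{t,t',U}(ω ∘ α) = e^{t,−t',U}(ω) + U(1 − ρ(ω))`: the staggered automorphism
REVERSES the diagonal hopping). The translation-invariant mean-energy minimisers of the grand-canonical pencil
`H^{t,t',U} − μN` are carried by `α` onto those of `H^{t,−t',U} − (U − μ)N` (`e_{U−μ}^{−t'}(σ ∘ α) = e_μ^{t'}(σ) + (2μ − U)`), and
`Re ω(P₀^d)` is invariant (`InfVolFermionStateParticleHolePairAmplitude`); since `m⋆ = dWaveOrderParameterTT' t' U μ` is the
LARGEST `Re ω(P₀^d)` over that class and is attained (`DWaveOrderParameterQuasiAverageState`), the order parameter of the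
electron-doped side `(t', μ > U/2)` IS that of the hole-doped side at the REVERSED diagonal hopping `(−t', U − μ)`:

* `IsTranslationInvariant.meanEnergy_hubbardTTPrimeMu_particleHole_tPrime` — `e^{t,t'}_{U−μ}(σ ∘ α) = e^{t,−t'}_μ(σ) + (2μ − U)`;
* `IsMeanEnergyMinimiser.particleHole_tPrime` — minimisers at `(t', μ)` ↦ minimisers at `(−t', U − μ)`;
* `dWaveOrderParameterTT'_le_particleHole`, **`dWaveOrderParameterTT'_particleHole`**:
  `dWaveOrderParameterTT' (−t') U (U − μ) = dWaveOrderParameterTT' t' U μ`; **`hasDWaveOrderTT'_particleHole_iff`**.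

Consequence for the cuprate programme: every certified CEILING / FLOOR / ABSENT word on the `d`-wave order parameter of the
one-band model at a hole-doped point `(t', U, μ)` is the same word at the electron-doped mirror point `(−t', U, U − μ)` (and a
`t' < 0` hole-doped cuprate box mirrors a `t' > 0` electron-doped box) — an exact symmetry of the ONE-BAND model, not of the materials.
Everything PROVED; no definition, no named fact, zero compute.

References: E. H. Lieb, PRL 62 (1989) 1201, proof of Thm 2 [LiebPRL1989]; E. H. Lieb, F. Y. Wu, Physica A 321 (2003) 1, §1 eq. (3)
[LiebWuPhysicaA2003]; T. Koma, H. Tasaki, J. Stat. Phys. 76 (1994) 745, §1 [KomaTasaki1994]; F. H. L. Essler et al. (2005) §2.2.4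
[EsslerEtAl2005]; O. Bratteli, A. Kishimoto, D. W. Robinson, CMP 64 (1978) 41, §3 [BratteliKishimotoRobinson1978].

## Mathlib / tree search
REUSED: `IsTranslationInvariant.meanEnergy_hubbardTTPrime_particleHole` (this seat, `HubbardTTPrimeSourcedParticleHole`),
`meanEnergy_hubbardTTPrimeMu`, `density_particleHole`, `particleHole_particleHole`, `IsTranslationInvariant.particleHole`,
`exists_isMeanEnergyMinimiser_re_expect_localPairAt_eq_dWaveOrderParameterTT'`,
`IsMeanEnergyMinimiser.re_expect_localPairAt_le_dWaveOrderParameterTT'`, `re_particleHole_expect_localPairAt_dWave`.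
`lean search 'dWaveOrderParameterTT.*particleHole'`: only `dWaveOrderParameterTT'_zero_particleHole` (`t' = 0`).
-/

noncomputable section

namespace Literature.MathematicalPhysics.QuantumLattice

open Matrix Finset HubbardWave0 Literature.Probability.LatticeModels ThermodynamicLimit Set
open scoped ComplexOrder BigOperators

namespace InfVolFermionState

variable {ω : InfVolFermionState 2} (t t' U μ : ℝ)

/-- **`e^{t,t'}_{U−μ}(σ ∘ α) = e^{t,−t'}_μ(σ) + (2μ − U)`** for translation-invariant `σ` (the `μ`-pencil: `ρ(σ ∘ α) = 2 − ρ(σ)`).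
[cite: LiebPRL1989, proof of Theorem 2] [cite: LiebWuPhysicaA2003, §1 eq. (3)] -/
theorem IsTranslationInvariant.meanEnergy_hubbardTTPrimeMu_particleHole_tPrime (hω : ω.IsTranslationInvariant) :
    ω.particleHole.meanEnergy (hubbardTTPrimeMuInteraction t t' U (U - μ)) 1 =
      ω.meanEnergy (hubbardTTPrimeMuInteraction t (-t') U μ) 1 + (2 * μ - U) := by
  rw [meanEnergy_hubbardTTPrimeMu, meanEnergy_hubbardTTPrimeMu, hω.meanEnergy_hubbardTTPrime_particleHole,
    density_particleHole]
  ring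

/-- **Minimisers at `(t', μ)` are mapped to minimisers at `(−t', U − μ)`** (the involution `α` preserves translation invariance
and shifts every pencil mean energy of the mirrored pencil by the same constant).
[cite: LiebPRL1989, proof of Theorem 2] [cite: BratteliKishimotoRobinson1978, Thm. 2 (condition 2)] -/
theorem IsMeanEnergyMinimiser.particleHole_tPrime (h : ω.IsMeanEnergyMinimiser (hubbardTTPrimeMuInteraction t t' U μ) 1) :
    ω.particleHole.IsMeanEnergyMinimiser (hubbardTTPrimeMuInteraction t (-t') U (U - μ)) 1 := by
  refine ⟨h.1.particleHole (h.1.isEven two_pos), fun ω' hω' => ?_⟩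
  have hω'ph : ω'.particleHole.IsTranslationInvariant := hω'.particleHole (hω'.isEven two_pos)
  have h2 := h.2 ω'.particleHole hω'ph
  have key := hω'ph.meanEnergy_hubbardTTPrimeMu_particleHole_tPrime t (-t') U μ
  rw [particleHole_particleHole, neg_neg] at key
  have k1 := h.1.meanEnergy_hubbardTTPrimeMu_particleHole_tPrime t (-t') U μ
  rw [neg_neg] at k1
  rw [k1]
  linarith

end InfVolFermionState

/-! ### The order parameter -/

section OrderParameter

variable (t' U μ : ℝ)

/-- `m⋆(t', U; μ) ≤ m⋆(−t', U; U − μ)`: the maximising ground state at `(t', μ)` is carried to a ground state at `(−t', U − μ)`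
with the same `Re ω(P₀^d)`. [cite: KomaTasaki1994, §1] [cite: LiebPRL1989, proof of Theorem 2] -/
theorem dWaveOrderParameterTT'_le_particleHole :
    dWaveOrderParameterTT' t' U μ ≤ dWaveOrderParameterTT' (-t') U (U - μ) := by
  obtain ⟨ω, hω, hωe⟩ := exists_isMeanEnergyMinimiser_re_expect_localPairAt_eq_dWaveOrderParameterTT' t' U μ
  have hle := (hω.particleHole_tPrime 1 t' U μ).re_expect_localPairAt_le_dWaveOrderParameterTT'
  rw [ω.re_particleHole_expect_localPairAt_dWave] at hle
  rwa [hωe] at hle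

/-- **PARTICLE–HOLE SYMMETRY OF THE `d`-WAVE ORDER PARAMETER, `t' ≠ 0`: `m⋆(−t', U; U − μ) = m⋆(t', U; μ)`** — the
electron-doped side at diagonal hopping `t'` carries the Koma–Tasaki quasi-average `d`-wave order parameter of the hole-doped
side at `−t'`; any certified ceiling on one side is a ceiling on the other.
[cite: KomaTasaki1994, §1] [cite: LiebWuPhysicaA2003, §1 eq. (3)] [cite: EsslerEtAl2005, §2.2.4] -/
theorem dWaveOrderParameterTT'_particleHole :
    dWaveOrderParameterTT' (-t') U (U - μ) = dWaveOrderParameterTT' t' U μ := by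
  refine le_antisymm ?_ (dWaveOrderParameterTT'_le_particleHole t' U μ)
  have h := dWaveOrderParameterTT'_le_particleHole (-t') U (U - μ)
  rwa [neg_neg, sub_sub_cancel] at h

/-- **`d`-wave ORDER (Koma–Tasaki sense) is particle–hole symmetric up to `t' ↦ −t'`**:
`HasDWaveOrderTT' (−t') U (U − μ) ↔ HasDWaveOrderTT' t' U μ`. [cite: KomaTasaki1994, §1] [cite: LiebPRL1989, proof of Theorem 2] -/
theorem hasDWaveOrderTT'_particleHole_iff : HasDWaveOrderTT' (-t') U (U - μ) ↔ HasDWaveOrderTT' t' U μ := by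
  rw [HasDWaveOrderTT', HasDWaveOrderTT', dWaveOrderParameterTT'_particleHole]

end OrderParameter


/-! ### The sourced energy density FUNCTION (appended, g8): `e_src(t', U, U − μ, h) = e_src(−t', U, μ, h) + (2μ − U)` -/

namespace InfVolFermionState

variable {ω : InfVolFermionState 2}

/-- **The sourced `μ`-pencil at the mirror chemical potential**: for translation-invariant `σ`,
`e^{src}_{t,t',U,U−μ,h}(σ ∘ α) = e^{src}_{t,−t',U,μ,h}(σ) + (2μ − U)` (the density-dependent parts cancel at `μ ↦ U − μ`).
[cite: LiebPRL1989, proof of Theorem 2] [cite: KomaTasaki1994, §1] -/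
theorem IsTranslationInvariant.meanEnergy_hubbardTTPrimeSourced_dWave_particleHole_sub (hω : ω.IsTranslationInvariant)
    (t t' U μ h : ℝ) :
    ω.particleHole.meanEnergy (hubbardTTPrimeSourcedInteraction t t' U (U - μ) dWaveFormFactor h) 1 =
      ω.meanEnergy (hubbardTTPrimeSourcedInteraction t (-t') U μ dWaveFormFactor h) 1 + (2 * μ - U) := by
  rw [hω.meanEnergy_hubbardTTPrimeSourced_dWave_particleHole t t' U (U - μ) h, meanEnergy_hubbardTTPrimeSourced,
    meanEnergy_hubbardTTPrimeSourced]
  ring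

end InfVolFermionState

section EnergyDensity

variable (t' U μ h : ℝ)

/-- **PARTICLE–HOLE SYMMETRY OF THE SOURCED GROUND-STATE ENERGY DENSITY** (every source `h`, every `t'`):
`dWaveSourceEnergyDensityTT' t' U (U − μ) h = dWaveSourceEnergyDensityTT' (−t') U μ h + (2μ − U)` — the translation-invariant
variational minimum (`le_dWaveSourceEnergyDensityTT'_iff`) is taken over a class that `α` maps onto itself, shifting every energy by the
same constant. Hence every certified sourced WINDOW / KKT / chord certificate at `(t', μ, h)` is one at `(−t', U − μ, h)`, and the cusp at
`h = 0` (the order parameter) is the same (`dWaveOrderParameterTT'_particleHole`). [cite: LiebWuPhysicaA2003, §1 eq. (3)] [cite: KomaTasaki1994, §1] -/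
theorem dWaveSourceEnergyDensityTT'_particleHole :
    dWaveSourceEnergyDensityTT' t' U (U - μ) h = dWaveSourceEnergyDensityTT' (-t') U μ h + (2 * μ - U) := by
  refine le_antisymm ?_ ?_
  · have key : dWaveSourceEnergyDensityTT' t' U (U - μ) h - (2 * μ - U) ≤ dWaveSourceEnergyDensityTT' (-t') U μ h := by
      refine (le_dWaveSourceEnergyDensityTT'_iff (-t') U μ h _).2 fun ω hω => ?_
      have h1 := dWaveSourceEnergyDensityTT'_le_meanEnergy_sourced t' U (U - μ) h (hω.particleHole (hω.isEven two_pos))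
      rw [hω.meanEnergy_hubbardTTPrimeSourced_dWave_particleHole_sub 1 t' U μ h] at h1
      linarith
    linarith
  · refine (le_dWaveSourceEnergyDensityTT'_iff t' U (U - μ) h _).2 fun ω hω => ?_
    have hωph : ω.particleHole.IsTranslationInvariant := hω.particleHole (hω.isEven two_pos)
    have h1 := dWaveSourceEnergyDensityTT'_le_meanEnergy_sourced (-t') U μ h hωph
    have h2 := hωph.meanEnergy_hubbardTTPrimeSourced_dWave_particleHole_sub 1 t' U μ h
    rw [InfVolFermionState.particleHole_particleHole] at h2
    linarith

/-- The same with the roles exchanged: `e_src(−t', U, U − μ, h) = e_src(t', U, μ, h) + (2μ − U)`. [cite: LiebWuPhysicaA2003, §1 eq. (3)] -/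
theorem dWaveSourceEnergyDensityTT'_particleHole' :
    dWaveSourceEnergyDensityTT' (-t') U (U - μ) h = dWaveSourceEnergyDensityTT' t' U μ h + (2 * μ - U) := by
  have e := dWaveSourceEnergyDensityTT'_particleHole (-t') U μ h
  rwa [neg_neg] at e

end EnergyDensity

end Literature.MathematicalPhysics.QuantumLattice

end
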